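import Literature.NumberTheory.GaloisRepresentations.GenericWeilDeligneOrbit
import Literature.NumberTheory.GaloisRepresentations.GenericWeilDeligneOrbitGrading
import Literature.NumberTheory.GaloisRepresentations.GenericWeilDeligneOrbitSemisimple
import Literature.RepresentationTheory.Semisimple.GradedOrbitConj
import Literature.RepresentationTheory.Semisimple.SubrepresentationEquiv
import HarnessLib

/-!
# Generic Weil–Deligne representations form one orbit, II: discharge of AHTW2026 Prop. 6.0.5 (1)–(2)

Discharge of the named fact `WeilDeligneRep.AHTW2026_prop_6_0_5_generic_conj`
(`GenericWeilDeligneOrbit.lean`): for a non-archimedean local field `K`, a finite-dimensional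
complex space `V` and two Weil–Deligne representations `(ρ, N)`, `(ρ, N')` on `V` with the same
Frobenius-semisimple `ρ`, both *generic* (`Hom_WD((ρ,N),(ρ(1),N)) = 0`, A'Campo–Hevesi–Thorne–
Whitmore Def. 6.0.4), there is `g ∈ GL(V)` centralising `ρ(W_K)` with `g N = N' g` — i.e. the
generic `N ∈ P(ρ)` form a single `G(ρ)`-orbit (op. cit. Prop. 6.0.5 (1)–(2); in print deduced
from Vogan's finiteness of `G(r)\P(r)` and [A'C24, Lemma 3.1.9]).

## Proof (formalised here; the printed proof invokes the geometry of `P(r)`)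

Let `Φ` be a Frobenius (`deg Φ = 1`) and `m ≥ 1` with `S = ρ(Φᵐ)` central in `ρ(W_K)`
(`ρ(I_K)` is finite).  `S` is semisimple and invertible and `S N = qᵐ N S`, so `N` maps the
`μ`-eigenspace of `S` to the `qᵐμ`-eigenspace, and a morphism `f` to the twist maps it to the
`μ/qᵐ`-eigenspace.  Grouping eigenspaces by `⌊log_{qᵐ} |μ|⌋` (`exists_eigenGrading`) gives a
finite grading `V = ⨁ₖ Vₖ` by `W_K`-stable subspaces with `N`, `N'` of degree `+1` and every
`f ∈ Hom_WD(·, ·(1))` of degree `-1`.  Twisting the action on `Vₖ` by `‖·‖^{-k}`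
(`ρ̃(w) = q^{-k deg w} ρ(w)` on `Vₖ`, realised by block-scalar operators) makes `N`, `N'`
`ℂ[W_K]`-linear, identifies the degree `-1` `ℂ[W_K]`-endomorphisms commuting with `N` with
`Hom_WD((ρ,N),(ρ(1),N))`, and the degree `0` ones with the centraliser of `ρ(W_K)`.  Each
eigenspace of `S` is a semisimple `W_K`-module (`isSemisimpleRepresentation_of_frobenius_scalar`:
`Φᵐ` acts by a scalar, twist to a finite image and apply Maschke), hence so is `V` with the
twisted action, and the conjugacy theorem for generic degree-one endomorphisms of graded
semisimple modules (`Literature.RepresentationTheory.Semisimple.exists_graded_linearEquiv_conj`,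
the module-theoretic form of the uniqueness of the pairwise-unlinked Zelevinsky multisegment on a
given support) produces the required `g`.

* `generic_conj_of_graded_conj` — the reduction, with the conjugacy theorem as a hypothesis;
* `AHTW2026_prop_6_0_5_generic_conj_holds` — **the discharge**.

## References

* L. A'Campo, B. Hevesi, J. A. Thorne, D. Whitmore, *Local-global compatibility of automorphic
  Galois representations over CM fields at p*, arXiv:2607.11763 (2026), §6, Def. 6.0.4,
  Prop. 6.0.5 (PDF pp. 112–113). [AHTW2026]
* A. V. Zelevinsky, *Induced representations of reductive 𝔭-adic groups II*, Ann. Sci. ÉNS 13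
  (1980), §§4, 8 (segments, linked segments); D. A. Vogan, Contemp. Math. 145 (1993), Prop. 4.5.
-/

namespace Literature.NumberTheory.GaloisRepresentations

namespace WeilDeligneRep

open Module

section Main

open GaloisRepresentations.IsNonarchimedeanLocalField WeilGroup

/-- **Prop. 6.0.5 (1)–(2) of A'Campo–Hevesi–Thorne–Whitmore from the graded conjugacy
theorem.**  The named fact `AHTW2026_prop_6_0_5_generic_conj` follows from the conjugacy of
generic degree-one endomorphisms of graded semisimple modules
(`Literature.RepresentationTheory.Semisimple.exists_graded_linearEquiv_conj`, here the
hypothesis `hcore`): grade `V` by the eigenspaces of a central Frobenius power `S = ρ(Φᵐ)`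
grouped by `⌊log_{qᵐ} |μ|⌋`, twist the Weil action on the `k`-th piece by `‖·‖^{-k}` so that `N`,
`N'` become `ℂ[W_K]`-linear of degree `+1`, check that the twisted module is semisimple
(`ρ(I_K)` is finite and `Φᵐ` acts by scalars on each eigenspace), and read the graded
`ℂ[W_K]`-automorphism `g` back as an element of the centraliser of `ρ(W_K)`.
[cite: AHTW2026, Prop. 6.0.5 (1)–(2) and Def. 6.0.4, PDF pp. 112–113] -/
theorem generic_conj_of_graded_conj
    (hcore : ∀ {R : Type} [Ring R] [Algebra ℂ R] {M : Type} [AddCommGroup M] [Module ℂ M]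
      [Module R M] [IsScalarTower ℂ R M] [FiniteDimensional ℂ M] [IsSemisimpleModule R M]
      (gr : ℕ → Submodule R M) (_ : iSupIndep gr) (_ : ⨆ k, gr k = ⊤)
      (Nb : ℕ) (_ : ∀ k, Nb ≤ k → gr k = ⊥)
      (t t' : M →ₗ[R] M) (_ : ∀ k, ∀ x ∈ gr k, t x ∈ gr (k + 1))
      (_ : ∀ k, ∀ x ∈ gr k, t' x ∈ gr (k + 1))
      (_ : ∀ f : M →ₗ[R] M, (∀ x ∈ gr 0, f x = 0) →
        (∀ k, ∀ x ∈ gr (k + 1), f x ∈ gr k) → f ∘ₗ t = t ∘ₗ f → f = 0)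
      (_ : ∀ f : M →ₗ[R] M, (∀ x ∈ gr 0, f x = 0) →
        (∀ k, ∀ x ∈ gr (k + 1), f x ∈ gr k) → f ∘ₗ t' = t' ∘ₗ f → f = 0),
      ∃ g : M ≃ₗ[R] M, (∀ k, ∀ x ∈ gr k, g x ∈ gr k) ∧ ∀ x, g (t x) = t' (g x)) :
    AHTW2026_prop_6_0_5_generic_conj := by
  intro K _ _ _ _ V _ _ _ W W' hρ hss hW hW'
  classical
  have hmul : IsFrobPow.mul (F := K) := IsFrobPow.mul_holds
  have huniq : IsFrobPow.unique (F := K) := IsFrobPow.unique_holds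
  set ρ := W.ρ with hρdef
  have hq0 : (residueFieldCard K : ℂ) ≠ 0 := by exact_mod_cast residueFieldCard_ne_zero K
  -- Frobenius and a central power
  obtain ⟨Φ, hΦ⟩ := exists_deg_eq_one (F := K)
  obtain ⟨m, hm, hcommI⟩ := W.exists_commute_pow_of_mem_inertia Φ
  set S : Module.End ℂ V := ρ (Φ ^ m) with hSdef
  have hSinj : Function.Injective S :=
    ((Module.End.isUnit_iff _).mp ((Group.isUnit (Φ ^ m)).map ρ)).1
  have hdecomp : ∀ w : WeilGroup K, w = Φ ^ (deg w) * (Φ ^ (-deg w) * w) := fun w => by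
    rw [← mul_assoc, zpow_neg, mul_inv_cancel, one_mul]
  have hcommS : ∀ w, S * ρ w = ρ w * S := by
    intro w
    have hi : Φ ^ (-deg w) * w ∈ inertia K := zpow_neg_deg_mul_mem_inertia hΦ w
    have h1 : S * ρ (Φ ^ (-deg w) * w) = ρ (Φ ^ (-deg w) * w) * S := by
      have h := congrArg Units.val (hcommI _ hi).eq
      simp only [Units.val_mul, Units.val_pow_eq_pow_val, MonoidHom.coe_toHomUnits] at h
      rw [hSdef, map_pow]
      exact h
    have h2 : S * ρ (Φ ^ (deg w)) = ρ (Φ ^ (deg w)) * S := by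
      have hc : Commute (Φ ^ m) (Φ ^ (deg w)) := ((Commute.refl Φ).pow_left m).zpow_right (deg w)
      exact (hc.map ρ).eq
    conv_lhs => rw [hdecomp w, map_mul, ← mul_assoc, h2, mul_assoc, h1, ← mul_assoc]
    conv_rhs => rw [hdecomp w, map_mul]
  -- the scaling factor `Q = q ^ m`
  set Q : ℕ := residueFieldCard K ^ m with hQdef
  have hQ : 1 < Q := Nat.one_lt_pow hm.ne' (one_lt_residueFieldCard K)
  have hQC : ((residueFieldCard K : ℂ) ^ (m : ℤ)) = (Q : ℂ) := by
    rw [hQdef, Nat.cast_pow, zpow_natCast]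
  have hdegΦm : deg (Φ ^ m) = m := by rw [deg_pow, hΦ, mul_one]
  have hSN : S ∘ₗ W.N = (Q : ℂ) • (W.N ∘ₗ S) := by
    have := W.conj_N (Φ ^ m); rwa [hdegΦm, hQC] at this
  have hSN' : S ∘ₗ W'.N = (Q : ℂ) • (W'.N ∘ₗ S) := by
    have := W'.conj_N (Φ ^ m); rw [hρ] at this; rwa [hdegΦm, hQC] at this
  -- the eigen-grading
  obtain ⟨gr, Nb, hind, hsup, hNb, hEle, hstab, hraise, hlower⟩ :=
    exists_eigenGrading S (hss (Φ ^ m)) hSinj hQ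
  have hInt : DirectSum.IsInternal gr :=
    (DirectSum.isInternal_submodule_iff_iSupIndep_and_iSup_eq_top gr).mpr ⟨hind, hsup⟩
  have hρgr : ∀ w k, ∀ x ∈ gr k, ρ w x ∈ gr k := fun w k x hx => hstab (ρ w) (hcommS w).symm k x hx
  have hext : ∀ f g : V →ₗ[ℂ] V, (∀ k, ∀ x ∈ gr k, f x = g x) → f = g :=
    linearMap_eq_of_eq_on_iSup gr hsup
  -- the twisting scalars
  let cf : WeilGroup K → ℕ → ℂ := fun w k => (residueFieldCard K : ℂ) ^ (-((k : ℤ) * deg w))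
  have hcf_one : ∀ k, cf 1 k = 1 := fun k => by
    change (residueFieldCard K : ℂ) ^ (-((k : ℤ) * deg (1 : WeilGroup K))) = 1
    rw [deg_one hmul huniq, mul_zero, neg_zero, zpow_zero]
  have hcf_mul : ∀ w w' k, cf (w * w') k = cf w k * cf w' k := fun w w' k => by
    change (residueFieldCard K : ℂ) ^ (-((k : ℤ) * deg (w * w'))) = _
    rw [deg_mul hmul huniq, ← zpow_add₀ hq0]
    congr 1; ring
  have hcf_ne : ∀ w k, cf w k ≠ 0 := fun w k => zpow_ne_zero _ hq0
  have hcf_succ : ∀ w k, cf w (k + 1) * (residueFieldCard K : ℂ) ^ (deg w) = cf w k := fun w k => by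
    change (residueFieldCard K : ℂ) ^ (-(((k + 1 : ℕ) : ℤ) * deg w)) * _ = (residueFieldCard K : ℂ) ^ _
    rw [← zpow_add₀ hq0]
    congr 1; push_cast; ring
  have hcf_inertia : ∀ w, w ∈ inertia K → ∀ k, cf w k = 1 := fun w hw k => by
    change (residueFieldCard K : ℂ) ^ (-((k : ℤ) * deg w)) = 1
    rw [deg_eq_zero_of_mem_inertia hw, mul_zero, neg_zero, zpow_zero]
  -- block-scalar operators and the twisted representation
  choose D hD using fun w => exists_blockScalar gr hInt (cf w)
  have hD1 : D 1 = 1 := hext _ _ fun k x hx => by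
    rw [hD 1 k x hx, hcf_one, one_smul]; rfl
  have hDmul : ∀ w w', D (w * w') = D w * D w' := fun w w' => hext _ _ fun k x hx => by
    rw [Module.End.mul_apply, hD w' k x hx, map_smul, hD w k x hx, hD (w * w') k x hx, smul_smul,
      hcf_mul, mul_comm]
  have hDρ : ∀ w w', D w * ρ w' = ρ w' * D w := fun w w' => hext _ _ fun k x hx => by
    rw [Module.End.mul_apply, Module.End.mul_apply, hD w k _ (hρgr w' k x hx), hD w k x hx, map_smul]
  let ρt : Representation ℂ (WeilGroup K) V :=
    { toFun := fun w => ρ w * D w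
      map_one' := by rw [map_one, hD1, mul_one]
      map_mul' := fun w w' => by
        rw [map_mul, hDmul, mul_assoc, ← mul_assoc (ρ w'), ← hDρ w w']
        simp only [mul_assoc] }
  have hρt_apply : ∀ w, ρt w = ρ w * D w := fun w => rfl
  have hρt : ∀ w k, ∀ x ∈ gr k, ρt w x = cf w k • ρ w x := fun w k x hx => by
    rw [hρt_apply, Module.End.mul_apply, hD w k x hx, map_smul]
  have hρtgr : ∀ w k, ∀ x ∈ gr k, ρt w x ∈ gr k := fun w k x hx => by
    rw [hρt w k x hx]; exact Submodule.smul_mem _ _ (hρgr w k x hx)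
  have hρt_inertia : ∀ w, w ∈ inertia K → ρt w = ρ w := fun w hw => hext _ _ fun k x hx => by
    rw [hρt w k x hx, hcf_inertia w hw, one_smul]
  -- eigenspaces of `S` are `ρt`-stable
  have hEst : ∀ μ w, ∀ x ∈ S.eigenspace μ, ρt w x ∈ S.eigenspace μ := by
    intro μ w x hx
    obtain ⟨k, hk⟩ := hEle μ
    rw [hρt w k x (hk hx)]
    refine Submodule.smul_mem _ _ ?_
    rw [Module.End.mem_eigenspace_iff] at hx ⊢
    rw [← Module.End.mul_apply, hcommS w, Module.End.mul_apply, hx, map_smul]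
  let Esub : ℂ → Subrepresentation ρt := fun μ => ⟨S.eigenspace μ, fun w x hx => hEst μ w x hx⟩
  -- each eigenspace is a semisimple `W_K`-representation
  have hfinIt : ((fun w => ρt w) '' (inertia K : Set (WeilGroup K))).Finite := by
    refine (W.finite_image_inertia.image Units.val).subset ?_
    rintro _ ⟨i, hi, rfl⟩
    exact ⟨ρ.toHomUnits i, ⟨i, hi, rfl⟩, (hρt_inertia i hi).symm⟩
  have hEss : ∀ μ : ℂ, μ ≠ 0 → ((Esub μ).toRepresentation).IsSemisimpleRepresentation := by
    intro μ hμ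
    obtain ⟨k, hk⟩ := hEle μ
    refine isSemisimpleRepresentation_of_frobenius_scalar ρt hΦ hm (Esub μ)
      (mul_ne_zero (hcf_ne (Φ ^ m) k) hμ) (fun x hx => ?_) hfinIt
    rw [hρt (Φ ^ m) k x (hk hx), mul_smul]
    congr 1
    exact Module.End.mem_eigenspace_iff.mp hx
  -- hence the twisted module is semisimple
  haveI hssMod : IsSemisimpleModule (MonoidAlgebra ℂ (WeilGroup K)) ρt.asModule := by
    refine isSemisimpleModule_of_isSemisimpleModule_submodule (s := {μ : ℂ | μ ≠ 0})
      (p := fun μ => (Esub μ).asSubmodule) ?_ ?_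
    · intro μ hμ
      haveI := hEss μ hμ
      have e := Literature.RepresentationTheory.Semisimple.Subrepresentation.asModuleEquiv (Esub μ)
      rw [← e.isSemisimpleModule_iff]
      exact (Representation.isSemisimpleRepresentation_iff_isSemisimpleModule_asModule _).mp (hEss μ hμ)
    · rw [eq_top_iff]
      rintro x -
      have hx : (ρt.asModuleEquiv x : V) ∈ ⨆ μ, S.eigenspace μ := by
        rw [(hss (Φ ^ m)).iSup_eigenspace_eq_top]; exact Submodule.mem_top
      have key : ∀ v : V, v ∈ (⨆ μ, S.eigenspace μ) →
          ρt.asModuleEquiv.symm v ∈ ⨆ μ ∈ {μ : ℂ | μ ≠ 0}, (Esub μ).asSubmodule := by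
        intro v hv
        refine Submodule.iSup_induction _
          (motive := fun v : V => ρt.asModuleEquiv.symm v ∈ ⨆ μ ∈ {μ : ℂ | μ ≠ 0}, (Esub μ).asSubmodule)
          hv ?_ (by rw [map_zero]; exact zero_mem _) ?_
        · intro μ v hv
          by_cases hμ : μ = 0
          · have : v = 0 := by
              rw [hμ, Module.End.eigenspace_zero, LinearMap.mem_ker] at hv
              exact hSinj (by rw [hv, map_zero])
            rw [this, map_zero]; exact zero_mem _
          · exact Submodule.mem_iSup_of_mem μ (Submodule.mem_iSup_of_mem hμ hv)
        · intro v w hv hw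
          rw [map_add]; exact add_mem hv hw
      simpa using key _ hx
  -- the grading over the group algebra
  let GR : ℕ → Subrepresentation ρt := fun k => ⟨gr k, fun w x hx => hρtgr w k x hx⟩
  let grR : ℕ → Submodule (MonoidAlgebra ℂ (WeilGroup K)) ρt.asModule := fun k => (GR k).asSubmodule
  have hmemR : ∀ k (x : ρt.asModule), x ∈ grR k ↔ (ρt.asModuleEquiv x : V) ∈ gr k := fun k x => Iff.rfl
  have hsupR : ⨆ k, grR k = ⊤ := by
    rw [eq_top_iff]
    rintro x -
    have hx : (ρt.asModuleEquiv x : V) ∈ ⨆ k, gr k := hsup ▸ Submodule.mem_top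
    have key : ∀ v : V, v ∈ (⨆ k, gr k) → ρt.asModuleEquiv.symm v ∈ ⨆ k, grR k := by
      intro v hv
      refine Submodule.iSup_induction _ (motive := fun v : V => ρt.asModuleEquiv.symm v ∈ ⨆ k, grR k)
        hv (fun k v hv => Submodule.mem_iSup_of_mem k hv) (by rw [map_zero]; exact zero_mem _) ?_
      intro v w hv hw
      rw [map_add]; exact add_mem hv hw
    simpa using key _ hx
  have hindR : iSupIndep grR := by
    rw [iSupIndep_def]
    intro i
    rw [Submodule.disjoint_def]
    intro x hx hx'
    have h1 : (ρt.asModuleEquiv x : V) ∈ gr i := hx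
    have h2 : (ρt.asModuleEquiv x : V) ∈ ⨆ (j) (_ : j ≠ i), gr j := by
      refine Submodule.iSup_induction _
        (motive := fun y : ρt.asModule => (ρt.asModuleEquiv y : V) ∈ ⨆ (j) (_ : j ≠ i), gr j)
        hx' ?_ (by rw [map_zero]; exact zero_mem _) ?_
      · intro j y hy
        by_cases hj : j ≠ i
        · rw [iSup_pos hj] at hy
          exact Submodule.mem_iSup_of_mem j (Submodule.mem_iSup_of_mem hj hy)
        · rw [iSup_neg hj, Submodule.mem_bot] at hy
          rw [hy, map_zero]; exact zero_mem _
      · intro y z hy hz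
        rw [map_add]; exact add_mem hy hz
    have := (Submodule.disjoint_def.mp (iSupIndep_def.mp hind i)) _ h1 h2
    exact ρt.asModuleEquiv.injective (by rw [this, map_zero])
  have hNbR : ∀ k, Nb ≤ k → grR k = ⊥ := by
    intro k hk
    rw [eq_bot_iff]
    intro x hx
    have : (ρt.asModuleEquiv x : V) ∈ gr k := hx
    rw [hNb k hk, Submodule.mem_bot] at this
    rw [Submodule.mem_bot]
    exact ρt.asModuleEquiv.injective (by rw [this, map_zero])
  -- `N`, `N'` are `ℂ[W_K]`-linear for the twisted structure
  have hN'conj : ∀ w, ρ w ∘ₗ W'.N = ((residueFieldCard K : ℂ) ^ (deg w)) • (W'.N ∘ₗ ρ w) := by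
    intro w; have := W'.conj_N w; rwa [hρ] at this
  have hNt : ∀ (Nop : V →ₗ[ℂ] V), (∀ w, ρ w ∘ₗ Nop = ((residueFieldCard K : ℂ) ^ (deg w)) • (Nop ∘ₗ ρ w)) →
      S ∘ₗ Nop = (Q : ℂ) • (Nop ∘ₗ S) → ∀ w, Nop ∘ₗ ρt w = ρt w ∘ₗ Nop := by
    intro Nop hconj hSNop w
    apply hext
    intro k x hx
    rw [LinearMap.comp_apply, LinearMap.comp_apply, hρt w k x hx, map_smul,
      hρt w (k + 1) _ (hraise Nop hSNop k x hx)]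
    have h1 : ρ w (Nop x) = (residueFieldCard K : ℂ) ^ (deg w) • Nop (ρ w x) := congr($(hconj w) x)
    rw [h1, smul_smul, hcf_succ]
  let tR : ρt.asModule →ₗ[MonoidAlgebra ℂ (WeilGroup K)] ρt.asModule :=
    Representation.IntertwiningMap.equivLinearMapAsModule ρt ρt ⟨W.N, hNt W.N W.conj_N hSN⟩
  let tR' : ρt.asModule →ₗ[MonoidAlgebra ℂ (WeilGroup K)] ρt.asModule :=
    Representation.IntertwiningMap.equivLinearMapAsModule ρt ρt ⟨W'.N, hNt W'.N hN'conj hSN'⟩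
  have htR : ∀ x, ρt.asModuleEquiv (tR x) = W.N (ρt.asModuleEquiv x) := fun x => rfl
  have htR' : ∀ x, ρt.asModuleEquiv (tR' x) = W'.N (ρt.asModuleEquiv x) := fun x => rfl
  have htRdeg : ∀ k, ∀ x ∈ grR k, tR x ∈ grR (k + 1) := fun k x hx => hraise W.N hSN k _ hx
  have htR'deg : ∀ k, ∀ x ∈ grR k, tR' x ∈ grR (k + 1) := fun k x hx => hraise W'.N hSN' k _ hx
  -- genericity transfers to the twisted module
  have hgenR : ∀ (Nop : V →ₗ[ℂ] V),
      (∀ f : V →ₗ[ℂ] V, (∀ w, f ∘ₗ ρ w = ((residueFieldCard K : ℂ) ^ (deg w)) • (ρ w ∘ₗ f)) →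
        f ∘ₗ Nop = Nop ∘ₗ f → f = 0) →
      ∀ (tt : ρt.asModule →ₗ[MonoidAlgebra ℂ (WeilGroup K)] ρt.asModule),
      (∀ x, ρt.asModuleEquiv (tt x) = Nop (ρt.asModuleEquiv x)) →
      ∀ f : ρt.asModule →ₗ[MonoidAlgebra ℂ (WeilGroup K)] ρt.asModule, (∀ x ∈ grR 0, f x = 0) →
        (∀ k, ∀ x ∈ grR (k + 1), f x ∈ grR k) → f ∘ₗ tt = tt ∘ₗ f → f = 0 := by
    intro Nop hgenN tt htt f hf0 hf1 hft
    let F : V →ₗ[ℂ] V :=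
      ρt.asModuleEquiv.toLinearMap ∘ₗ (f.restrictScalars ℂ) ∘ₗ ρt.asModuleEquiv.symm.toLinearMap
    have hFdef : ∀ v, F v = ρt.asModuleEquiv (f (ρt.asModuleEquiv.symm v)) := fun v => rfl
    have hFf : ∀ x : ρt.asModule, F (ρt.asModuleEquiv x) = ρt.asModuleEquiv (f x) := fun x => by
      rw [hFdef, LinearEquiv.symm_apply_apply]
    have hfρt : ∀ w (x : ρt.asModule),
        f (ρt.asModuleEquiv.symm (ρt w (ρt.asModuleEquiv x))) =
          ρt.asModuleEquiv.symm (ρt w (ρt.asModuleEquiv (f x))) := by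
      intro w x
      have h := f.map_smul (MonoidAlgebra.single w (1 : ℂ)) x
      rw [Representation.single_smul, Representation.single_smul, one_smul, one_smul] at h
      exact h
    have hFρt : ∀ w (v : V), F (ρt w v) = ρt w (F v) := by
      intro w v
      have h := hfρt w (ρt.asModuleEquiv.symm v)
      rw [LinearEquiv.apply_symm_apply] at h
      rw [hFdef, hFdef, h, LinearEquiv.apply_symm_apply]
    have hF1 : ∀ w, F ∘ₗ ρ w = ((residueFieldCard K : ℂ) ^ (deg w)) • (ρ w ∘ₗ F) := by
      intro w
      refine hext _ _ fun k x hx => ?_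
      change F (ρ w x) = ((residueFieldCard K : ℂ) ^ (deg w)) • ρ w (F x)
      obtain _ | k := k
      · have h0 : F (ρ w x) = 0 := by
          have := hf0 (ρt.asModuleEquiv.symm (ρ w x)) (hρgr w 0 x hx)
          have h := hFf (ρt.asModuleEquiv.symm (ρ w x))
          rw [this, map_zero] at h
          simpa using h
        have h0' : F x = 0 := by
          have := hf0 (ρt.asModuleEquiv.symm x) hx
          have h := hFf (ρt.asModuleEquiv.symm x)
          rw [this, map_zero] at h
          simpa using h
        rw [h0, h0', map_zero, smul_zero]
      · have hFx : F x ∈ gr k := by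
          have := hf1 k (ρt.asModuleEquiv.symm x) hx
          have h := hFf (ρt.asModuleEquiv.symm x)
          rw [LinearEquiv.apply_symm_apply] at h
          rw [h]
          exact this
        have h := hFρt w x
        rw [hρt w (k + 1) x hx, map_smul, hρt w k _ hFx, ← hcf_succ w k, mul_smul] at h
        exact smul_right_injective V (hcf_ne w (k + 1)) h
    have hF2 : F ∘ₗ Nop = Nop ∘ₗ F := by
      ext v
      have h := congr($hft (ρt.asModuleEquiv.symm v))
      simp only [LinearMap.comp_apply] at h
      have h' := congrArg ρt.asModuleEquiv h
      rw [htt, ← hFf, ← hFf, htt] at h'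
      simpa using h'
    have hF : F = 0 := hgenN F hF1 hF2
    ext x
    have h := hFf x
    rw [hF, LinearMap.zero_apply] at h
    exact ρt.asModuleEquiv.injective (by rw [← h, LinearMap.zero_apply, map_zero])
  have hW'' : ∀ f : V →ₗ[ℂ] V, (∀ w, f ∘ₗ ρ w = ((residueFieldCard K : ℂ) ^ (deg w)) • (ρ w ∘ₗ f)) →
      f ∘ₗ W'.N = W'.N ∘ₗ f → f = 0 := by
    intro f hf
    have := hW' f
    rw [hρ] at this
    exact this hf
  -- the graded conjugacy theorem
  obtain ⟨g, hg_gr, hg_t⟩ := hcore grR hindR hsupR Nb hNbR tR tR' htRdeg htR'deg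
    (hgenR W.N hW tR htR) (hgenR W'.N hW'' tR' htR')
  -- read `g` back on `V`
  let G : V ≃ₗ[ℂ] V := ρt.asModuleEquiv.symm ≪≫ₗ (g.restrictScalars ℂ) ≪≫ₗ ρt.asModuleEquiv
  have hGdef : ∀ v, G v = ρt.asModuleEquiv (g (ρt.asModuleEquiv.symm v)) := fun v => rfl
  have hGg : ∀ x : ρt.asModule, G (ρt.asModuleEquiv x) = ρt.asModuleEquiv (g x) := fun x => by
    rw [hGdef, LinearEquiv.symm_apply_apply]
  have hgρt : ∀ w (x : ρt.asModule),
      g (ρt.asModuleEquiv.symm (ρt w (ρt.asModuleEquiv x))) =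
        ρt.asModuleEquiv.symm (ρt w (ρt.asModuleEquiv (g x))) := by
    intro w x
    have h := g.map_smul (MonoidAlgebra.single w (1 : ℂ)) x
    rw [Representation.single_smul, Representation.single_smul, one_smul, one_smul] at h
    exact h
  have hGρt : ∀ w (v : V), G (ρt w v) = ρt w (G v) := by
    intro w v
    have h := hgρt w (ρt.asModuleEquiv.symm v)
    rw [LinearEquiv.apply_symm_apply] at h
    rw [hGdef, hGdef, h, LinearEquiv.apply_symm_apply]
  have hGgr : ∀ k, ∀ v ∈ gr k, G v ∈ gr k := by
    intro k v hv
    have := hg_gr k (ρt.asModuleEquiv.symm v) hv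
    have h := hGg (ρt.asModuleEquiv.symm v)
    rw [LinearEquiv.apply_symm_apply] at h
    rw [h]; exact this
  refine ⟨G, fun w => ?_, ?_⟩
  · apply hext
    intro k x hx
    rw [LinearMap.comp_apply, LinearMap.comp_apply, LinearEquiv.coe_coe]
    have h := hGρt w x
    rw [hρt w k x hx, map_smul, hρt w k _ (hGgr k x hx)] at h
    exact smul_right_injective V (hcf_ne w k) h
  · ext v
    rw [LinearMap.comp_apply, LinearMap.comp_apply, LinearEquiv.coe_coe]
    have h := congrArg ρt.asModuleEquiv (hg_t (ρt.asModuleEquiv.symm v))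
    rw [htR', ← hGg, htR, ← hGg] at h
    simpa using h

end Main

/-- **Discharge of the named fact `AHTW2026_prop_6_0_5_generic_conj`** (A'Campo–Hevesi–Thorne–
Whitmore 2026, Prop. 6.0.5 (1)–(2) with Def. 6.0.4): two generic monodromy operators on the same
Frobenius-semisimple Weil representation are conjugate under the centraliser of the Weil group.
[cite: AHTW2026, Prop. 6.0.5 (1)–(2) and Def. 6.0.4, PDF pp. 112–113] -/
theorem AHTW2026_prop_6_0_5_generic_conj_holds : AHTW2026_prop_6_0_5_generic_conj :=
  generic_conj_of_graded_conj (fun gr hind hsup Nb hNb t t' ht ht' hgen hgen' =>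
    Literature.RepresentationTheory.Semisimple.exists_graded_linearEquiv_conj ℂ gr hind hsup Nb
      hNb t t' ht ht' hgen hgen')

end WeilDeligneRep
end Literature.NumberTheory.GaloisRepresentations
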